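import Summits.CriticalPhenomena.PercolationContinuityZ3.Theorems.Transplant.SkelFrmQuasiBChoiceSlotsPx
import Summits.CriticalPhenomena.PercolationContinuityZ3.Theorems.Transplant.PlanarSkeletonFrmQuasiDefs
import Summits.CriticalPhenomena.PercolationContinuityZ3.Theorems.Transplant.SkelFrmQuasi1ChoiceDefs
import Summits.CriticalPhenomena.PercolationContinuityZ3.Theorems.Transplant.SkelFrmQuasi1ParamsLBL
import Summits.CriticalPhenomena.PercolationContinuityZ3.Theorems.Transplant.SkelFrmQuasi1SlotTypes
import Summits.CriticalPhenomena.PercolationContinuityZ3.Theorems.Transplant.SkelFrmQuasiBChoiceDefs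
import Summits.CriticalPhenomena.PercolationContinuityZ3.Theorems.Transplant.SkelFrmQuasiBChoiceDefsV
import Summits.CriticalPhenomena.PercolationContinuityZ3.Theorems.Transplant.SkelFrmQuasiBChoiceResidQV
import Summits.CriticalPhenomena.PercolationContinuityZ3.Theorems.Transplant.SkelFrmQuasiBChoiceResidR
import Summits.CriticalPhenomena.PercolationContinuityZ3.Theorems.Transplant.SkelFrmQuasiBParamsSlotsT
import Summits.CriticalPhenomena.PercolationContinuityZ3.Theorems.Transplant.SkelFrmQuasi1SlotTypes
import HarnessLib

/-!
# GEN-Q PORT (WAVE-Q table v0.8 section 2, row G270, U-level L?; captain R-6/R-7 2026-08-27: carrier token swap `PlanarSkeletonFrmFrom ↦ PlanarSkeletonFrmQuasi`)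
# of the tree module «Transplant/SkelFrmFromBChoiceSlotCongrPx» (sha256 ae59e97b9f1f8ba3…) onto the quasi-step carrier `PlanarSkeletonFrmQuasi` (p507026): «SkelFrmQuasiBChoiceSlotCongrPx»

ORIGINAL TITLE: 

builds on p205010 (kernel theorem, internal audit signed; external expert review pending) — nothing in this file uses p205010; NOTHING is claimed about any open node
((N3-b), the end state).  Lane `prim-bschramm`, seat `prim-bschramm-gen-1` (gen 5; WAVE-Q captain).  Helper file (`--supports stmt-CriticalPhenomena-4575 --as helper`).
PORT RULES (U-wave r1–r4 re-used, GEN-Q hunk classes of p3-g29 #6136): declaration order, names and proof texts are those of «SkelFrmFromBChoiceSlotCongrPx», byte-identical except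
(i) the carrier token `PlanarSkeletonFrmFrom ↦ PlanarSkeletonFrmQuasi` in binders, `namespace`/`end` lines and qualified names (module names `SkelFrmFrom… ↦ SkelFrmQuasi…`
in imports of already-ported rows); (ii) `Φ.step ↦ Φ.qstep` with the called Steps lemma replaced by its `…Q`/`_q` twin and the cost `Φ.M` threaded (none in this file unless
listed below); (iii) `Φ.cyl_connected ↦ Φ.cyl_reach` readers (none unless listed); (iv) graph-ball radii / window floors ×`Φ.M` (none unless listed); r2 (U-wave rule, tool T8 = p3-g30's inline_r2.py): the section `variable` binders that bind the carrier are inlined into 13 kept header(s) (the gate's dedup otherwise reads a carrier-free header as a restatement of the FrmFrom twin).  Carrier-free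
residents stay imported/exported from the original «SkelFrmBChoiceSlotCongrPx» exactly as in the FrmFrom port.  Docstrings and citations are the original's.
Row G270 (gen-1 g5).
-/

noncomputable section

open scoped Classical

namespace Summit.CriticalPhenomena.PercolationContinuityZ3.Theorems.Transplant

open MeasureTheory Literature.Probability.Percolation Literature.Probability.LatticeModels SimpleGraph KNCells KNLevels
open SkelConc (Consts)
open Skelφ.StepI (DataN DataNS OutNS)

namespace PlanarSkeletonFrmQuasi

export PlanarSkeletonFrmFrom.NegB (RK)  -- T3-auto: resident alias(es) replicated from the FrmFrom namespace

namespace NegB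

open Neg

section Congr

variable {κ : Consts} {V : Type} [DecidableEq V] [Countable V] {G : SimpleGraph V} [G.LocallyFinite] {Φ : PlanarSkeletonFrmQuasi G} {t : V} {p : unitInterval}
  {hC : Φ.CylSubcritical p} {Pv : PSlot} {Sv : SSlot} {cv hv : CSlot} {bv : BSlot} {O : OutNS V} {q : unitInterval}
  {gv₁ gv₂ fv₁ fv₂ : Neg.FSlot}

/-! ## §1 The slot values at the merged record -/

/-- Box slots agreeing at `O.merged` have the same `gOf`. [folklore] -/
theorem gOf_congr {κ : Consts} {V : Type} [DecidableEq V] [Countable V] {G : SimpleGraph V} [G.LocallyFinite] {Φ : PlanarSkeletonFrmQuasi G} {t : V} {p : unitInterval} {O : OutNS V} {gv₁ : Neg.FSlot} {gv₂ : Neg.FSlot} (hg : gv₁ κ Φ t p O.merged = gv₂ κ Φ t p O.merged) : gOf κ Φ t p O gv₁ = gOf κ Φ t p O gv₂ := hg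

/-- Width slots agreeing at `O.merged` have the same `fOf`. [folklore] -/
theorem fOf_congr {κ : Consts} {V : Type} [DecidableEq V] [Countable V] {G : SimpleGraph V} [G.LocallyFinite] {Φ : PlanarSkeletonFrmQuasi G} {t : V} {p : unitInterval} {O : OutNS V} {fv₁ : Neg.FSlot} {fv₂ : Neg.FSlot} (hf : fv₁ κ Φ t p O.merged = fv₂ κ Φ t p O.merged) : fOf κ Φ t p O fv₁ = fOf κ Φ t p O fv₂ := hf

/-- … the same creep value `cOf`. [folklore] -/
theorem cOf_congr {κ : Consts} {V : Type} [DecidableEq V] [Countable V] {G : SimpleGraph V} [G.LocallyFinite] {Φ : PlanarSkeletonFrmQuasi G} {t : V} {p : unitInterval} {cv : CSlot} {O : OutNS V} {gv₁ : Neg.FSlot} {gv₂ : Neg.FSlot} {fv₁ : Neg.FSlot} {fv₂ : Neg.FSlot} (hg : gv₁ κ Φ t p O.merged = gv₂ κ Φ t p O.merged) (hf : fv₁ κ Φ t p O.merged = fv₂ κ Φ t p O.merged) :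
    cOf κ Φ t p O gv₁ fv₁ cv = cOf κ Φ t p O gv₂ fv₂ cv := by
  unfold cOf; rw [gOf_congr hg, fOf_congr hf]

/-- … the same forward-room value `hOf`. [folklore] -/
theorem hOf_congr {κ : Consts} {V : Type} [DecidableEq V] [Countable V] {G : SimpleGraph V} [G.LocallyFinite] {Φ : PlanarSkeletonFrmQuasi G} {t : V} {p : unitInterval} {hv : CSlot} {O : OutNS V} {gv₁ : Neg.FSlot} {gv₂ : Neg.FSlot} {fv₁ : Neg.FSlot} {fv₂ : Neg.FSlot} (hg : gv₁ κ Φ t p O.merged = gv₂ κ Φ t p O.merged) (hf : fv₁ κ Φ t p O.merged = fv₂ κ Φ t p O.merged) :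
    hOf κ Φ t p O gv₁ fv₁ hv = hOf κ Φ t p O gv₂ fv₂ hv := by
  unfold hOf; rw [gOf_congr hg, fOf_congr hf]

/-- … the same arrival boxes `bOf`. [folklore] -/
theorem bOf_congr {κ : Consts} {V : Type} [DecidableEq V] [Countable V] {G : SimpleGraph V} [G.LocallyFinite] {Φ : PlanarSkeletonFrmQuasi G} {t : V} {p : unitInterval} {bv : BSlot} {O : OutNS V} {gv₁ : Neg.FSlot} {gv₂ : Neg.FSlot} {fv₁ : Neg.FSlot} {fv₂ : Neg.FSlot} (hg : gv₁ κ Φ t p O.merged = gv₂ κ Φ t p O.merged) (hf : fv₁ κ Φ t p O.merged = fv₂ κ Φ t p O.merged) :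
    bOf κ Φ t p O gv₁ fv₁ bv = bOf κ Φ t p O gv₂ fv₂ bv := by
  unfold bOf; rw [gOf_congr hg, fOf_congr hf]

/-! ## §2 The scheme, face data and level data of record -/

/-- Slots agreeing at `O.merged` give the same scheme of record `ΓQV` at `(O, q)`. [folklore] -/
theorem ΓQV_congr {κ : Consts} {V : Type} [DecidableEq V] [Countable V] {G : SimpleGraph V} [G.LocallyFinite] {Φ : PlanarSkeletonFrmQuasi G} {t : V} {p : unitInterval} {Sv : SSlot} {cv : CSlot} {hv : CSlot} {bv : BSlot} {O : OutNS V} {q : unitInterval} {gv₁ : Neg.FSlot} {gv₂ : Neg.FSlot} {fv₁ : Neg.FSlot} {fv₂ : Neg.FSlot} (hg : gv₁ κ Φ t p O.merged = gv₂ κ Φ t p O.merged) (hf : fv₁ κ Φ t p O.merged = fv₂ κ Φ t p O.merged) :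
    ΓQV κ Φ t p O gv₁ fv₁ Sv cv hv bv q = ΓQV κ Φ t p O gv₂ fv₂ Sv cv hv bv q := by
  unfold ΓQV; rw [gOf_congr hg, fOf_congr hf, cOf_congr hg hf, hOf_congr hg hf, bOf_congr hg hf]

/-- … the same face data `FDQV`. [folklore] -/
theorem FDQV_congr {κ : Consts} {V : Type} [DecidableEq V] [Countable V] {G : SimpleGraph V} [G.LocallyFinite] {Φ : PlanarSkeletonFrmQuasi G} {t : V} {p : unitInterval} {Sv : SSlot} {cv : CSlot} {hv : CSlot} {O : OutNS V} {q : unitInterval} {gv₁ : Neg.FSlot} {gv₂ : Neg.FSlot} {fv₁ : Neg.FSlot} {fv₂ : Neg.FSlot} (hg : gv₁ κ Φ t p O.merged = gv₂ κ Φ t p O.merged) (hf : fv₁ κ Φ t p O.merged = fv₂ κ Φ t p O.merged) :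
    FDQV κ Φ t p O gv₁ fv₁ Sv cv hv q = FDQV κ Φ t p O gv₂ fv₂ Sv cv hv q := by
  unfold FDQV; rw [gOf_congr hg, fOf_congr hf, cOf_congr hg hf, hOf_congr hg hf]

-- GEN-Q (R-2, captain 2026-08-27): `PlanarSkeletonFrmFrom.NegB.LDQV_congr` is not in the used cone of the node top — not ported.

/-! ## §3 The choice data of record -/

/-- **`AtQNQ` CONGRUENCE**: slots agreeing at `O.merged` give the same premises at `q` (the only slot-dependent datum `AtQNQ` reads is the pair list
`SMn O = SMnP … (gOf …) (fOf …) Pv`). [this work] -/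
theorem atQ3V_congr {κ : Consts} {V : Type} [DecidableEq V] [Countable V] {G : SimpleGraph V} [G.LocallyFinite] {Φ : PlanarSkeletonFrmQuasi G} {t : V} {p : unitInterval} {hC : Φ.CylSubcritical p} {Pv : PSlot} {Sv : SSlot} {cv : CSlot} {hv : CSlot} {bv : BSlot} {O : OutNS V} {q : unitInterval} {gv₁ : Neg.FSlot} {gv₂ : Neg.FSlot} {fv₁ : Neg.FSlot} {fv₂ : Neg.FSlot} (hg : gv₁ κ Φ t p O.merged = gv₂ κ Φ t p O.merged) (hf : fv₁ κ Φ t p O.merged = fv₂ κ Φ t p O.merged) :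
    (choiceAtQ3V κ Φ t p Pv gv₁ fv₁ Sv cv hv bv hC).AtQNQ O q ↔ (choiceAtQ3V κ Φ t p Pv gv₂ fv₂ Sv cv hv bv hC).AtQNQ O q := by
  have hS : (choiceAtQ3V κ Φ t p Pv gv₁ fv₁ Sv cv hv bv hC).SMn O = (choiceAtQ3V κ Φ t p Pv gv₂ fv₂ Sv cv hv bv hC).SMn O := by
    show SMnP κ Φ t p O.merged (gOf κ Φ t p O gv₁) (fOf κ Φ t p O fv₁) Pv = SMnP κ Φ t p O.merged (gOf κ Φ t p O gv₂) (fOf κ Φ t p O fv₂) Pv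
    rw [gOf_congr hg, fOf_congr hf]
  unfold ChoiceNQ.AtQNQ
  rw [hS]
  exact Iff.rfl

/-- **Scheme congruence**: slots agreeing at `O.merged` give the same scheme at `(O, q)`. [folklore] -/
theorem scheme_congr {κ : Consts} {V : Type} [DecidableEq V] [Countable V] {G : SimpleGraph V} [G.LocallyFinite] {Φ : PlanarSkeletonFrmQuasi G} {t : V} {p : unitInterval} {hC : Φ.CylSubcritical p} {Pv : PSlot} {Sv : SSlot} {cv : CSlot} {hv : CSlot} {bv : BSlot} {O : OutNS V} {q : unitInterval} {gv₁ : Neg.FSlot} {gv₂ : Neg.FSlot} {fv₁ : Neg.FSlot} {fv₂ : Neg.FSlot} (hg : gv₁ κ Φ t p O.merged = gv₂ κ Φ t p O.merged) (hf : fv₁ κ Φ t p O.merged = fv₂ κ Φ t p O.merged) :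
    (choiceAtQ3V κ Φ t p Pv gv₁ fv₁ Sv cv hv bv hC).scheme O q = (choiceAtQ3V κ Φ t p Pv gv₂ fv₂ Sv cv hv bv hC).scheme O q := by
  rw [choiceAtQ3V_scheme, choiceAtQ3V_scheme, ΓQV_congr hg hf]

/-- **Face-data congruence**. [folklore] -/
theorem FD_congr {κ : Consts} {V : Type} [DecidableEq V] [Countable V] {G : SimpleGraph V} [G.LocallyFinite] {Φ : PlanarSkeletonFrmQuasi G} {t : V} {p : unitInterval} {hC : Φ.CylSubcritical p} {Pv : PSlot} {Sv : SSlot} {cv : CSlot} {hv : CSlot} {bv : BSlot} {O : OutNS V} {q : unitInterval} {gv₁ : Neg.FSlot} {gv₂ : Neg.FSlot} {fv₁ : Neg.FSlot} {fv₂ : Neg.FSlot} (hg : gv₁ κ Φ t p O.merged = gv₂ κ Φ t p O.merged) (hf : fv₁ κ Φ t p O.merged = fv₂ κ Φ t p O.merged) :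
    (choiceAtQ3V κ Φ t p Pv gv₁ fv₁ Sv cv hv bv hC).FD O q = (choiceAtQ3V κ Φ t p Pv gv₂ fv₂ Sv cv hv bv hC).FD O q := by
  rw [choiceAtQ3V_FD, choiceAtQ3V_FD, FDQV_congr hg hf]

-- GEN-Q (R-2, captain 2026-08-27): `PlanarSkeletonFrmFrom.NegB.LD_congr` is not in the used cone of the node top — not ported.

end Congr

/-! ## §4 The tuple of record versus the fixed-shape slots at the raised index (what the (F) top rewrites with) -/

section Tuple

variable {κ : Consts} {V : Type} [DecidableEq V] [Countable V] {G : SimpleGraph V} [G.LocallyFinite] {Φ : PlanarSkeletonFrmQuasi G} {t : V} {p : unitInterval}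
  {hC : Φ.CylSubcritical p} {Pv : PSlot} {Sv : SSlot} {cv hv : CSlot} {bv : BSlot} {O : OutNS V} {q : unitInterval} (D : ℕ)

/-- **`AtQNQ` AT THE TUPLE ⇔ `AtQNQ` AT THE FIXED-SHAPE SLOTS of the raised index `m′ := KS.RK t O.merged 0 + D`** — the (F) rows' `hAt`. [this work] -/
theorem atQ3V_tuplePx_iff {κ : Consts} {V : Type} [DecidableEq V] [Countable V] {G : SimpleGraph V} [G.LocallyFinite] {Φ : PlanarSkeletonFrmQuasi G} {t : V} {p : unitInterval} {hC : Φ.CylSubcritical p} {Pv : PSlot} {Sv : SSlot} {cv : CSlot} {hv : CSlot} {bv : BSlot} {O : OutNS V} {q : unitInterval} (D : ℕ) :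
    (choiceAtQ3V κ Φ t p Pv (gvPx D) (fvPx D) Sv cv hv bv hC).AtQNQ O q ↔
      (choiceAtQ3V κ Φ t p Pv
        (KS.gT (KS.RK t O.merged 0 + D) (gxQ (KS.RK t O.merged 0 + D) (gxR0 (KS.RK t O.merged 0 + D)) (fxR (KS.RK t O.merged 0 + D))))
        (KS.fT (KS.RK t O.merged 0 + D) (fxQ (KS.RK t O.merged 0 + D) (fxR (KS.RK t O.merged 0 + D)))) Sv cv hv bv hC).AtQNQ O q :=
  atQ3V_congr (gvPx_at κ Φ t p O.merged D) (fvPx_at κ Φ t p O.merged D)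

/-- **The scheme at the tuple = the scheme at the fixed-shape slots of the raised index.** [folklore] -/
theorem scheme_tuplePx_eq {κ : Consts} {V : Type} [DecidableEq V] [Countable V] {G : SimpleGraph V} [G.LocallyFinite] {Φ : PlanarSkeletonFrmQuasi G} {t : V} {p : unitInterval} {hC : Φ.CylSubcritical p} {Pv : PSlot} {Sv : SSlot} {cv : CSlot} {hv : CSlot} {bv : BSlot} {O : OutNS V} {q : unitInterval} (D : ℕ) :
    (choiceAtQ3V κ Φ t p Pv (gvPx D) (fvPx D) Sv cv hv bv hC).scheme O q =
      (choiceAtQ3V κ Φ t p Pv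
        (KS.gT (KS.RK t O.merged 0 + D) (gxQ (KS.RK t O.merged 0 + D) (gxR0 (KS.RK t O.merged 0 + D)) (fxR (KS.RK t O.merged 0 + D))))
        (KS.fT (KS.RK t O.merged 0 + D) (fxQ (KS.RK t O.merged 0 + D) (fxR (KS.RK t O.merged 0 + D)))) Sv cv hv bv hC).scheme O q :=
  scheme_congr (gvPx_at κ Φ t p O.merged D) (fvPx_at κ Φ t p O.merged D)

/-- **The face data at the tuple = the face data at the fixed-shape slots of the raised index.** [folklore] -/
theorem FD_tuplePx_eq {κ : Consts} {V : Type} [DecidableEq V] [Countable V] {G : SimpleGraph V} [G.LocallyFinite] {Φ : PlanarSkeletonFrmQuasi G} {t : V} {p : unitInterval} {hC : Φ.CylSubcritical p} {Pv : PSlot} {Sv : SSlot} {cv : CSlot} {hv : CSlot} {bv : BSlot} {O : OutNS V} {q : unitInterval} (D : ℕ) :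
    (choiceAtQ3V κ Φ t p Pv (gvPx D) (fvPx D) Sv cv hv bv hC).FD O q =
      (choiceAtQ3V κ Φ t p Pv
        (KS.gT (KS.RK t O.merged 0 + D) (gxQ (KS.RK t O.merged 0 + D) (gxR0 (KS.RK t O.merged 0 + D)) (fxR (KS.RK t O.merged 0 + D))))
        (KS.fT (KS.RK t O.merged 0 + D) (fxQ (KS.RK t O.merged 0 + D) (fxR (KS.RK t O.merged 0 + D)))) Sv cv hv bv hC).FD O q :=
  FD_congr (gvPx_at κ Φ t p O.merged D) (fvPx_at κ Φ t p O.merged D)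

-- GEN-Q (R-2, captain 2026-08-27): `PlanarSkeletonFrmFrom.NegB.gOf_gvPx` is not in the used cone of the node top — not ported.

-- GEN-Q (R-2, captain 2026-08-27): `PlanarSkeletonFrmFrom.NegB.fOf_fvPx` is not in the used cone of the node top — not ported.

end Tuple

end NegB

end PlanarSkeletonFrmQuasi

end Summit.CriticalPhenomena.PercolationContinuityZ3.Theorems.Transplant

end
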